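import Literature.NumberTheory.EllipticCurves.BinaryQuarticOneParameterSubgroups
import Mathlib.MeasureTheory.Function.Jacobian
import Mathlib.Analysis.Calculus.InverseFunctionTheorem.FDeriv
import Mathlib.Analysis.Calculus.Deriv.Pi
import Mathlib.Analysis.Calculus.FDeriv.Pi
import HarnessLib

/-!
# The change of variables `(g, r) ↦ g · p_r` of Bhargava–Shankar, Props. 2.7–2.8, in Iwasawa coordinates

Topic `Literature/NumberTheory/EllipticCurves`; continues `BinaryQuarticOneParameterSubgroups.lean`
(the inverse Iwasawa matrix `G(x,y,θ) = (ñ(x) ã(y) k(θ))⁻¹`, the derivatives of the substitution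
action along `ñ`, `a`, `k`, and the determinant identity `det_rows_iwasawa`). Everything here is
PROVED (no named facts).

Bhargava–Shankar (Ann. of Math. 181 (2015); Prop. 2.7 of `arXiv:1006.1002v2`): "for any
measurable function `φ` on `V_ℝ`, `(2/(27 nᵢ)) ∫_R ∫_{SL₂(ℝ)} φ(g · p_{I,J}) dg dI dJ = ∫_{V⁽ⁱ⁾}
φ(v) dv` ... follows from a Jacobian computation". This file carries out that Jacobian
computation as real analysis on `ℝ⁵` for an arbitrary differentiable two-parameter family of forms
`P(α, β)` (`SmoothFamily`; Bhargava–Shankar's `p_{I,J}` indexed by the invariants is the case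
`(α, β) = (I, J)`, but cone families `m · c(τ)` are what the counting uses):

* `psi S (x, y, θ, α, β) = coeffs (P(α,β) ∘ G(x,y,θ))`, the parametrisation of
  `SL₂(ℝ) · {P}` by `ℍ × SO(2) × (parameters)`;
* its five partial derivatives (`hasDerivAt_psi_zero` … `_four`): `A(G) · (−ℒ_e P)`,
  `A(G) · (−(1/2y) ℒ_{h−2xe} P)`, `A(G) · (−ℒ_Z P)` (`Z = Ad(G⁻¹) w`), `A(G) · P_α`,
  `A(G) · P_β`, via the one-parameter subgroups and the equivariance of `ℒ`;
* differentiability of `Ψ` (`differentiableAt_psi`, `fun_prop` on the explicit entries) and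
  **its Fréchet derivative = the Jacobian matrix** `jacMatrix = A(G) · [r₀ … r₄]`
  (`hasFDerivAt_psi`, by uniqueness of line derivatives);
* **`det DΨ = (1/27) y⁻² ∂(I,J)/∂(α,β)`** (`det_jacMatrix`, `det_mulVecCLM_jacMatrix`), where
  `∂(I,J)/∂(α,β) = dI_P(P_α) dJ_P(P_β) − dI_P(P_β) dJ_P(P_α)` (`jacIJ`) — this is
  Bhargava–Shankar's constant `2/27` for their Haar measure `dg`, which is `½ y⁻² dx dy dθ`;
* **the change of variables** (`volume_image_psi`, Mathlib's
  `lintegral_abs_det_fderiv_eq_addHaar_image`): for measurable `T ⊆ {y > 0}` on which `Ψ` is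
  injective, `vol(Ψ(T)) = ∫_T (1/27) y⁻² |∂(I,J)/∂(α,β)|`.

## References

* M. Bhargava, A. Shankar, Ann. of Math. (2) 181 (2015) 191–242, Props. 2.7–2.8
  (arXiv:1006.1002v2 numbering). [cite: BhargavaShankarAnnals2015, Props. 2.7–2.8 (the Jacobian computation; arXiv:1006.1002v2 numbering)]
-/

noncomputable section

open Real MeasureTheory Matrix

namespace Literature.NumberTheory.EllipticCurves

namespace BinaryQuartic

/-! ## Smooth two-parameter families of forms -/

/-- A differentiable two-parameter family of real binary quartic forms `P(α, β)` together with
its partial derivatives `P_α`, `P_β` (as forms). [folklore] -/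
structure SmoothFamily where
  /-- the family -/
  P : ℝ → ℝ → BinaryQuartic ℝ
  /-- its `α`-derivative -/
  Pα : ℝ → ℝ → BinaryQuartic ℝ
  /-- its `β`-derivative -/
  Pβ : ℝ → ℝ → BinaryQuartic ℝ
  /-- joint continuous differentiability of the coefficient `a` -/
  contDiff_a : ContDiff ℝ 1 fun q : ℝ × ℝ => (P q.1 q.2).a
  /-- joint continuous differentiability of the coefficient `b` -/
  contDiff_b : ContDiff ℝ 1 fun q : ℝ × ℝ => (P q.1 q.2).b
  /-- joint continuous differentiability of the coefficient `c` -/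
  contDiff_c : ContDiff ℝ 1 fun q : ℝ × ℝ => (P q.1 q.2).c
  /-- joint continuous differentiability of the coefficient `d` -/
  contDiff_d : ContDiff ℝ 1 fun q : ℝ × ℝ => (P q.1 q.2).d
  /-- joint continuous differentiability of the coefficient `e` -/
  contDiff_e : ContDiff ℝ 1 fun q : ℝ × ℝ => (P q.1 q.2).e
  /-- `P_α` is the `α`-derivative -/
  hasDerivAt_α : ∀ α β, HasDerivAt (fun s => (P s β).coeffs) (Pα α β).coeffs α
  /-- `P_β` is the `β`-derivative -/
  hasDerivAt_β : ∀ α β, HasDerivAt (fun s => (P α s).coeffs) (Pβ α β).coeffs β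

variable (S : SmoothFamily)

/-- The parametrisation `Ψ(x, y, θ, α, β) = G(x,y,θ) · P(α, β)` of `V_ℝ = ℝ⁵` (coefficients of
`P(α,β) ∘ G(x,y,θ)`, `G = (ñ(x) ã(y) k(θ))⁻¹`). [cite: BhargavaShankarAnnals2015, Props. 2.7–2.8 (the map (g, r) ↦ g · p_r; arXiv:1006.1002v2 numbering)] -/
def psi (p : Fin 5 → ℝ) : Fin 5 → ℝ :=
  ((S.P (p 3) (p 4)).subst (iwasawaG (p 0) (p 1) (p 2))).coeffs

/-- The direction `Z = Ad(G⁻¹) w = (−x/y, y + x²/y; −1/y, x/y)` of the `θ`-derivative. [folklore] -/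
def zDir (x y : ℝ) : Matrix (Fin 2) (Fin 2) ℝ := !![-(x * y⁻¹), y + x ^ 2 * y⁻¹; -y⁻¹, x * y⁻¹]

/-- The five rows `r_j` with `∂_j Ψ = A(G) r_j`: `−ℒ_e P`, `−(1/2y) ℒ_{h−2xe} P`, `−ℒ_Z P`,
`P_α`, `P_β`. [folklore] -/
def jacRow (p : Fin 5 → ℝ) : Fin 5 → (Fin 5 → ℝ) :=
  ![((-1 : ℝ) • lieDeriv !![0, 1; 0, 0] (S.P (p 3) (p 4))).coeffs,
    ((-(1 / (2 * p 1))) • lieDeriv !![1, -(2 * p 0); 0, -1] (S.P (p 3) (p 4))).coeffs,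
    ((-1 : ℝ) • lieDeriv (zDir (p 0) (p 1)) (S.P (p 3) (p 4))).coeffs,
    (S.Pα (p 3) (p 4)).coeffs, (S.Pβ (p 3) (p 4)).coeffs]

/-- The Jacobian matrix of `Ψ`: columns `A(G) r_j`. [folklore] -/
def jacMatrix (p : Fin 5 → ℝ) : Matrix (Fin 5) (Fin 5) ℝ :=
  actionMatrix (iwasawaG (p 0) (p 1) (p 2)) * (Matrix.of (jacRow S p))ᵀ

/-- The Jacobian factor `∂(I, J)/∂(α, β) = dI_P(P_α) dJ_P(P_β) − dI_P(P_β) dJ_P(P_α)`. [folklore] -/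
def jacIJ (α β : ℝ) : ℝ :=
  dI (S.P α β) (S.Pα α β) * dJ (S.P α β) (S.Pβ α β) - dI (S.P α β) (S.Pβ α β) * dJ (S.P α β) (S.Pα α β)

/-- **`det DΨ = (1/27) y⁻² ∂(I,J)/∂(α,β)`.** [cite: BhargavaShankarAnnals2015, Props. 2.7–2.8 (arXiv:1006.1002v2 numbering)] -/
theorem det_jacMatrix {p : Fin 5 → ℝ} (hy : 0 < p 1) :
    (jacMatrix S p).det = 1 / 27 * ((p 1)⁻¹) ^ 2 * jacIJ S (p 3) (p 4) := by
  rw [jacMatrix, Matrix.det_mul, det_actionMatrix, det_iwasawaG hy, one_pow, one_mul,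
    Matrix.det_transpose]
  have h := det_rows_iwasawa (S.P (p 3) (p 4)) (S.Pα (p 3) (p 4)) (S.Pβ (p 3) (p 4))
    (p 0) (p 1) (p 1)⁻¹ (1 / (2 * p 1))
  have e : Matrix.of (jacRow S p) = Matrix.of ![((-1 : ℝ) • lieDeriv !![0, 1; 0, 0] (S.P (p 3) (p 4))).coeffs,
      ((-(1 / (2 * p 1))) • lieDeriv !![1, -(2 * p 0); 0, -1] (S.P (p 3) (p 4))).coeffs,
      ((-1 : ℝ) • lieDeriv !![-(p 0 * (p 1)⁻¹), p 1 + p 0 ^ 2 * (p 1)⁻¹; -(p 1)⁻¹, p 0 * (p 1)⁻¹]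
        (S.P (p 3) (p 4))).coeffs,
      (S.Pα (p 3) (p 4)).coeffs, (S.Pβ (p 3) (p 4)).coeffs] := rfl
  rw [e]
  have h27 : (27 : ℝ) ≠ 0 := by norm_num
  have hy0 : p 1 ≠ 0 := hy.ne'
  apply mul_left_cancel₀ h27
  rw [h, jacIJ]
  field_simp

/-- The `j`-th column of the Jacobian matrix is `A(G) r_j`. [folklore] -/
theorem jacMatrix_mulVec_single (p : Fin 5 → ℝ) (j : Fin 5) :
    jacMatrix S p *ᵥ Pi.single j 1 = actionMatrix (iwasawaG (p 0) (p 1) (p 2)) *ᵥ jacRow S p j := by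
  rw [jacMatrix, ← Matrix.mulVec_mulVec]
  congr 1
  ext i
  rw [Matrix.mulVec_single_one]
  rfl

/-! ## The directional derivatives of `Ψ` -/

/-- The linear map `v ↦ A v` as a continuous linear map. [folklore] -/
def mulVecCLM (A : Matrix (Fin 5) (Fin 5) ℝ) : (Fin 5 → ℝ) →L[ℝ] (Fin 5 → ℝ) :=
  LinearMap.toContinuousLinearMap (Matrix.mulVecLin A)

/-- `mulVecCLM A v = A v`. [folklore] -/
theorem mulVecCLM_apply (A : Matrix (Fin 5) (Fin 5) ℝ) (v : Fin 5 → ℝ) : mulVecCLM A v = A *ᵥ v := rfl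

/-- Composition of a differentiable curve with `v ↦ A v`. [folklore] -/
theorem hasDerivAt_mulVec {c : ℝ → Fin 5 → ℝ} {c' : Fin 5 → ℝ} {t : ℝ} (A : Matrix (Fin 5) (Fin 5) ℝ)
    (hc : HasDerivAt c c' t) : HasDerivAt (fun s => A *ᵥ c s) (A *ᵥ c') t :=
  (mulVecCLM A).hasFDerivAt.comp_hasDerivAt t hc

variable {S}

/-- `Ψ` along the `x`-direction: `Ψ(s, y, θ, α, β) = A(G) · coeffs(P ∘ ñ(x − s))`. [folklore] -/
theorem psi_update_zero (p : Fin 5 → ℝ) (s : ℝ) :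
    psi S (Function.update p 0 s) =
      actionMatrix (iwasawaG (p 0) (p 1) (p 2)) *ᵥ ((S.P (p 3) (p 4)).subst (upperShear (p 0 - s))).coeffs := by
  rw [psi]
  simp only [Function.update_self, ne_eq, Fin.reduceEq, not_false_eq_true, Function.update_of_ne]
  rw [show s = p 0 + (s - p 0) by ring, iwasawaG_add_x, subst_mul, coeffs_subst]
  congr 2
  ring_nf

/-- **`∂Ψ/∂x = A(G) · (−ℒ_e P)`.** [folklore] -/
theorem hasDerivAt_psi_zero (p : Fin 5 → ℝ) :
    HasDerivAt (fun s => psi S (Function.update p 0 s))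
      (actionMatrix (iwasawaG (p 0) (p 1) (p 2)) *ᵥ jacRow S p 0) (p 0) := by
  have e : (fun s => psi S (Function.update p 0 s)) = fun s =>
      actionMatrix (iwasawaG (p 0) (p 1) (p 2)) *ᵥ ((S.P (p 3) (p 4)).subst (upperShear (p 0 - s))).coeffs :=
    funext fun s => psi_update_zero p s
  rw [e]
  apply hasDerivAt_mulVec
  -- inner: `s ↦ coeffs (P ∘ ñ(x - s))`
  have hlin : HasDerivAt (fun s => p 0 - s) (-1) (p 0) := by
    simpa using ((hasDerivAt_id (p 0)).const_sub (p 0))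
  have hg := hasDerivAt_coeffs_subst_upperShear (S.P (p 3) (p 4))
  have hg' : HasDerivAt (fun u => ((S.P (p 3) (p 4)).subst (upperShear u)).coeffs)
      (lieDeriv !![0, 1; 0, 0] (S.P (p 3) (p 4))).coeffs (p 0 - p 0) := by
    rw [sub_self]; exact hg
  have := hg'.scomp (p 0) hlin
  simp only [jacRow, Matrix.cons_val_zero, coeffs_smul']
  exact this

/-- **`∂Ψ/∂θ = A(G) · (−ℒ_Z P)`**, `Z = Ad(G⁻¹) w`. [folklore] -/
theorem hasDerivAt_psi_two (p : Fin 5 → ℝ) (hy : 0 < p 1) :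
    HasDerivAt (fun s => psi S (Function.update p 2 s))
      (actionMatrix (iwasawaG (p 0) (p 1) (p 2)) *ᵥ jacRow S p 2) (p 2) := by
  have e : (fun s => psi S (Function.update p 2 s)) = fun s =>
      (((S.P (p 3) (p 4)).subst (iwasawaG (p 0) (p 1) (p 2))).subst (rotR (p 2 - s))).coeffs := by
    funext s
    rw [psi]
    simp only [Function.update_self, ne_eq, Fin.reduceEq, not_false_eq_true, Function.update_of_ne]
    rw [show s = p 2 + (s - p 2) by ring, iwasawaG_add_theta, subst_mul]
    congr 2; ring
  rw [e]
  have hlin : HasDerivAt (fun s => p 2 - s) (-1) (p 2) := by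
    simpa using ((hasDerivAt_id (p 2)).const_sub (p 2))
  have hg := hasDerivAt_coeffs_subst_rotR ((S.P (p 3) (p 4)).subst (iwasawaG (p 0) (p 1) (p 2)))
  have hg' : HasDerivAt (fun u => (((S.P (p 3) (p 4)).subst (iwasawaG (p 0) (p 1) (p 2))).subst (rotR u)).coeffs)
      (lieDeriv !![0, 1; -1, 0] ((S.P (p 3) (p 4)).subst (iwasawaG (p 0) (p 1) (p 2)))).coeffs (p 2 - p 2) := by
    rw [sub_self]; exact hg
  have h := hg'.scomp (p 2) hlin
  -- identify `ℒ_w (f ∘ G) = (ℒ_Z f) ∘ G`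
  have hZ : lieDeriv !![0, 1; -1, 0] ((S.P (p 3) (p 4)).subst (iwasawaG (p 0) (p 1) (p 2))) =
      (lieDeriv (zDir (p 0) (p 1)) (S.P (p 3) (p 4))).subst (iwasawaG (p 0) (p 1) (p 2)) := by
    have h1 := det_smul_lieDeriv_subst (zDir (p 0) (p 1)) (iwasawaG (p 0) (p 1) (p 2)) (S.P (p 3) (p 4))
    rw [det_iwasawaG hy, one_smul, adjugate_iwasawaG hy] at h1
    rw [h1]
    congr 1
    rw [zDir, ← iwasawaGinv_w_iwasawaG hy (p 2) (x := p 0)]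
    simp only [Matrix.mul_assoc]
    rw [iwasawaG_mul_iwasawaGinv hy, Matrix.mul_one, ← Matrix.mul_assoc, iwasawaG_mul_iwasawaGinv hy,
      Matrix.one_mul]
  rw [hZ, coeffs_subst] at h
  have e2 : actionMatrix (iwasawaG (p 0) (p 1) (p 2)) *ᵥ jacRow S p 2 =
      (-1 : ℝ) • (actionMatrix (iwasawaG (p 0) (p 1) (p 2)) *ᵥ
        (lieDeriv (zDir (p 0) (p 1)) (S.P (p 3) (p 4))).coeffs) := by
    simp only [jacRow, Matrix.cons_val]
    rw [coeffs_smul', Matrix.mulVec_smul]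
  rw [e2]
  exact h

/-- **`∂Ψ/∂α = A(G) · P_α`.** [folklore] -/
theorem hasDerivAt_psi_three (p : Fin 5 → ℝ) :
    HasDerivAt (fun s => psi S (Function.update p 3 s))
      (actionMatrix (iwasawaG (p 0) (p 1) (p 2)) *ᵥ jacRow S p 3) (p 3) := by
  have e : (fun s => psi S (Function.update p 3 s)) = fun s =>
      actionMatrix (iwasawaG (p 0) (p 1) (p 2)) *ᵥ (S.P s (p 4)).coeffs := by
    funext s
    rw [psi, coeffs_subst]
    simp
  rw [e]
  exact hasDerivAt_mulVec _ (S.hasDerivAt_α (p 3) (p 4))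

/-- **`∂Ψ/∂β = A(G) · P_β`.** [folklore] -/
theorem hasDerivAt_psi_four (p : Fin 5 → ℝ) :
    HasDerivAt (fun s => psi S (Function.update p 4 s))
      (actionMatrix (iwasawaG (p 0) (p 1) (p 2)) *ᵥ jacRow S p 4) (p 4) := by
  have e : (fun s => psi S (Function.update p 4 s)) = fun s =>
      actionMatrix (iwasawaG (p 0) (p 1) (p 2)) *ᵥ (S.P (p 3) s).coeffs := by
    funext s
    rw [psi, coeffs_subst]
    simp
  rw [e]
  exact hasDerivAt_mulVec _ (S.hasDerivAt_β (p 3) (p 4))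

/-- **`∂Ψ/∂y = A(G) · (−(1/2y) ℒ_{h−2xe} P)`.** [folklore] -/
theorem hasDerivAt_psi_one (p : Fin 5 → ℝ) (hy : 0 < p 1) :
    HasDerivAt (fun s => psi S (Function.update p 1 s))
      (actionMatrix (iwasawaG (p 0) (p 1) (p 2)) *ᵥ jacRow S p 1) (p 1) := by
  -- near `s = y`: `Ψ(update p 1 s) = A(G) (A(ñ x) coeffs((f ∘ ñ(−x)) ∘ a(u(s − y))))`
  have hev : (fun s => psi S (Function.update p 1 s)) =ᶠ[nhds (p 1)] fun s =>
      actionMatrix (iwasawaG (p 0) (p 1) (p 2)) *ᵥ (actionMatrix (upperShear (p 0)) *ᵥ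
        ((((S.P (p 3) (p 4)).subst (upperShear (-(p 0)))).subst
          (diagTorus (Real.sqrt (p 1) / Real.sqrt (p 1 + (s - p 1))))).coeffs)) := by
    filter_upwards [lt_mem_nhds hy] with s hs
    rw [psi]
    simp only [Function.update_self, ne_eq, Fin.reduceEq, not_false_eq_true, Function.update_of_ne]
    have hst : 0 < p 1 + (s - p 1) := by linarith
    rw [show iwasawaG (p 0) s (p 2) = iwasawaG (p 0) (p 1 + (s - p 1)) (p 2) by congr 1; ring,
      iwasawaG_add_y hy hst, subst_mul, coeffs_subst, subst_mul, subst_mul, coeffs_subst]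
  refine HasDerivAt.congr_of_eventuallyEq ?_ hev
  -- derivative of `s ↦ u (s - y)` at `y`
  have hlin : HasDerivAt (fun s => s - p 1) 1 (p 1) := by simpa using (hasDerivAt_id (p 1)).sub_const (p 1)
  have hu' : HasDerivAt (fun s => Real.sqrt (p 1) / Real.sqrt (p 1 + (s - p 1))) (-(1 / (2 * p 1))) (p 1) := by
    have h1 := hasDerivAt_sqrt_div_sqrt hy
    have h1' : HasDerivAt (fun t => Real.sqrt (p 1) / Real.sqrt (p 1 + t)) (-(1 / (2 * p 1))) (p 1 - p 1) := by
      rw [sub_self]; exact h1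
    have h2 := h1'.scomp (p 1) (h := fun s => s - p 1) hlin
    rw [one_smul] at h2
    exact h2
  have hu0 : Real.sqrt (p 1) / Real.sqrt (p 1 + (p 1 - p 1)) = 1 := by
    rw [sub_self, add_zero]; exact div_self (Real.sqrt_pos.2 hy).ne'
  have hg := hasDerivAt_coeffs_subst_diagTorus ((S.P (p 3) (p 4)).subst (upperShear (-(p 0))))
  have hg' : HasDerivAt (fun v => (((S.P (p 3) (p 4)).subst (upperShear (-(p 0)))).subst (diagTorus v)).coeffs)
      (lieDeriv !![1, 0; 0, -1] ((S.P (p 3) (p 4)).subst (upperShear (-(p 0))))).coeffs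
      (Real.sqrt (p 1) / Real.sqrt (p 1 + (p 1 - p 1))) := by
    rw [hu0]; exact hg
  have h := hg'.scomp (p 1) hu'
  have key := hasDerivAt_mulVec (actionMatrix (iwasawaG (p 0) (p 1) (p 2)))
    (hasDerivAt_mulVec (actionMatrix (upperShear (p 0))) h)
  -- identify the derivative
  have hconj : actionMatrix (upperShear (p 0)) *ᵥ
      (lieDeriv !![1, 0; 0, -1] ((S.P (p 3) (p 4)).subst (upperShear (-(p 0))))).coeffs =
      (lieDeriv !![1, -(2 * p 0); 0, -1] (S.P (p 3) (p 4))).coeffs := by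
    rw [← coeffs_subst]
    have h1 := det_smul_lieDeriv_subst !![1, 0; 0, -1] (upperShear (p 0))
      ((S.P (p 3) (p 4)).subst (upperShear (-(p 0))))
    rw [det_upperShear_eq_one, one_smul, adjugate_upperShear, upperShear_h_conj, ← subst_mul,
      upperShear_mul, add_neg_cancel] at h1
    rw [h1]
    congr 1
    rw [show upperShear 0 = 1 by ext i j; fin_cases i <;> fin_cases j <;> simp [upperShear], subst_one]
  have e2 : actionMatrix (iwasawaG (p 0) (p 1) (p 2)) *ᵥ jacRow S p 1 =
      actionMatrix (iwasawaG (p 0) (p 1) (p 2)) *ᵥ (actionMatrix (upperShear (p 0)) *ᵥ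
        ((-(1 / (2 * p 1))) • (lieDeriv !![1, 0; 0, -1] ((S.P (p 3) (p 4)).subst (upperShear (-(p 0))))).coeffs)) := by
    simp only [jacRow, Matrix.cons_val]
    rw [coeffs_smul', Matrix.mulVec_smul, Matrix.mulVec_smul, hconj, Matrix.mulVec_smul]
  rw [e2]
  exact key

/-! ## Differentiability of `Ψ` and its Fréchet derivative -/

/-- The entries of `G(x, y, θ)` are `C¹` in `(x, y, θ)` for `y > 0`. [folklore] -/
theorem contDiffAt_iwasawaG_entry (p : Fin 5 → ℝ) (hy : 0 < p 1) (k l : Fin 2) :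
    ContDiffAt ℝ 1 (fun q : Fin 5 → ℝ => iwasawaG (q 0) (q 1) (q 2) k l) p := by
  have h1 : p 1 ≠ 0 := hy.ne'
  have h2 : Real.sqrt (p 1) ≠ 0 := (Real.sqrt_pos.2 hy).ne'
  have h3 : (Real.sqrt (p 1))⁻¹ ≠ 0 := inv_ne_zero h2
  fin_cases k <;> fin_cases l <;>
    simp only [iwasawaG, rotR, diagTorus, upperShear, Matrix.mul_apply, Fin.sum_univ_two,
      Matrix.of_apply, Matrix.cons_val', Matrix.cons_val_zero, Matrix.cons_val_one,
      Matrix.cons_val_fin_one, Fin.isValue, Fin.zero_eta, Fin.mk_one] <;>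
    fun_prop (disch := assumption)

/-- `Ψ` is `C¹` at every point with `y > 0`. [folklore] -/
theorem contDiffAt_psi (p : Fin 5 → ℝ) (hy : 0 < p 1) : ContDiffAt ℝ 1 (psi S) p := by
  have hG := contDiffAt_iwasawaG_entry p hy
  have h34 : ContDiff ℝ 1 (fun q : Fin 5 → ℝ => (q 3, q 4)) := by fun_prop
  have hPa' : ContDiffAt ℝ 1 (fun q : Fin 5 → ℝ => (S.P (q 3) (q 4)).a) p :=
    (S.contDiff_a.comp h34).contDiffAt
  have hPb' : ContDiffAt ℝ 1 (fun q : Fin 5 → ℝ => (S.P (q 3) (q 4)).b) p :=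
    (S.contDiff_b.comp h34).contDiffAt
  have hPc' : ContDiffAt ℝ 1 (fun q : Fin 5 → ℝ => (S.P (q 3) (q 4)).c) p :=
    (S.contDiff_c.comp h34).contDiffAt
  have hPd' : ContDiffAt ℝ 1 (fun q : Fin 5 → ℝ => (S.P (q 3) (q 4)).d) p :=
    (S.contDiff_d.comp h34).contDiffAt
  have hPe' : ContDiffAt ℝ 1 (fun q : Fin 5 → ℝ => (S.P (q 3) (q 4)).e) p :=
    (S.contDiff_e.comp h34).contDiffAt
  set G : (Fin 5 → ℝ) → Matrix (Fin 2) (Fin 2) ℝ := fun q => iwasawaG (q 0) (q 1) (q 2) with hGdef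
  have e : psi S = fun q => ((S.P (q 3) (q 4)).subst (G q)).coeffs := rfl
  rw [e]
  have hG' : ∀ k l, ContDiffAt ℝ 1 (fun q => G q k l) p := hG
  have h00 := hG' 0 0; have h01 := hG' 0 1; have h10 := hG' 1 0; have h11 := hG' 1 1
  refine contDiffAt_pi.2 fun i => ?_
  fin_cases i <;>
    simp only [coeffs, subst, Matrix.cons_val_zero, Matrix.cons_val_one,
      Fin.isValue, Fin.zero_eta, Fin.mk_one, Fin.reduceFinMk, Matrix.cons_val] <;>
    fun_prop

/-- `Ψ` is differentiable at every point with `y > 0`. [folklore] -/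
theorem differentiableAt_psi (p : Fin 5 → ℝ) (hy : 0 < p 1) : DifferentiableAt ℝ (psi S) p :=
  (contDiffAt_psi p hy).differentiableAt one_ne_zero

/-- The Fréchet derivative of `Ψ` applied to the basis vector `e_j` is the `j`-th column of the
Jacobian matrix. [folklore] -/
theorem fderiv_psi_single (p : Fin 5 → ℝ) (hy : 0 < p 1) (j : Fin 5) :
    fderiv ℝ (psi S) p (Pi.single j 1) = jacMatrix S p *ᵥ Pi.single j 1 := by
  have hF := (differentiableAt_psi p hy (S := S)).hasFDerivAt
  -- derivative along the line `s ↦ update p j s`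
  have hline : HasDerivAt (Function.update p j) (Pi.single j 1) (p j) := hasDerivAt_update p j (p j)
  have hF' : HasFDerivAt (psi S) (fderiv ℝ (psi S) p) (Function.update p j (p j)) := by
    rw [Function.update_eq_self]; exact hF
  have hcomp : HasDerivAt (fun s => psi S (Function.update p j s)) (fderiv ℝ (psi S) p (Pi.single j 1))
      (p j) := hF'.comp_hasDerivAt (p j) hline
  rw [jacMatrix_mulVec_single]
  fin_cases j
  · exact hcomp.unique (hasDerivAt_psi_zero p)
  · exact hcomp.unique (hasDerivAt_psi_one p hy)
  · exact hcomp.unique (hasDerivAt_psi_two p hy)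
  · exact hcomp.unique (hasDerivAt_psi_three p)
  · exact hcomp.unique (hasDerivAt_psi_four p)

/-- **The Fréchet derivative of `Ψ` is the Jacobian matrix.** [folklore] -/
theorem hasFDerivAt_psi (p : Fin 5 → ℝ) (hy : 0 < p 1) :
    HasFDerivAt (psi S) (mulVecCLM (jacMatrix S p)) p := by
  have hF := (differentiableAt_psi p hy (S := S)).hasFDerivAt
  have e : fderiv ℝ (psi S) p = mulVecCLM (jacMatrix S p) := by
    apply ContinuousLinearMap.ext
    intro v
    have hv : v = ∑ j : Fin 5, v j • (Pi.single j (1 : ℝ) : Fin 5 → ℝ) := by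
      ext i
      simp [Finset.sum_apply, Pi.single_apply]
    rw [mulVecCLM_apply, hv]
    simp only [map_sum, Matrix.mulVec_sum]
    refine Finset.sum_congr rfl fun j _ => ?_
    rw [ContinuousLinearMap.map_smul, Matrix.mulVec_smul, fderiv_psi_single p hy]
  rw [← e]; exact hF

/-- `Ψ` is strictly differentiable (it is `C¹`), with derivative the Jacobian matrix. [folklore] -/
theorem hasStrictFDerivAt_psi (p : Fin 5 → ℝ) (hy : 0 < p 1) :
    HasStrictFDerivAt (psi S) (mulVecCLM (jacMatrix S p)) p := by
  have h := (contDiffAt_psi p hy (S := S)).hasStrictFDerivAt one_ne_zero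
  rwa [(hasFDerivAt_psi p hy).fderiv] at h

/-- **`|det DΨ| = (1/27) y⁻² |∂(I,J)/∂(α,β)|`.** [cite: BhargavaShankarAnnals2015, Props. 2.7–2.8 (arXiv:1006.1002v2 numbering)] -/
theorem det_mulVecCLM_jacMatrix {p : Fin 5 → ℝ} (hy : 0 < p 1) :
    (mulVecCLM (jacMatrix S p)).det = 1 / 27 * ((p 1)⁻¹) ^ 2 * jacIJ S (p 3) (p 4) := by
  rw [← det_jacMatrix S hy]
  rw [show (mulVecCLM (jacMatrix S p)).det = LinearMap.det (Matrix.mulVecLin (jacMatrix S p)) from rfl]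
  rw [← Matrix.toLin'_apply', LinearMap.det_toLin']

/-- **Local openness of `Ψ`** (inverse function theorem): where `∂(I,J)/∂(α,β) ≠ 0` (and
`y > 0`), `Ψ` maps neighbourhoods onto neighbourhoods. [folklore] -/
theorem map_nhds_psi (p : Fin 5 → ℝ) (hy : 0 < p 1) (hJ : jacIJ S (p 3) (p 4) ≠ 0) :
    Filter.map (psi S) (nhds p) = nhds (psi S p) := by
  have hdet : (mulVecCLM (jacMatrix S p)).det ≠ 0 := by
    rw [det_mulVecCLM_jacMatrix hy]
    have : (p 1)⁻¹ ≠ 0 := inv_ne_zero hy.ne'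
    positivity
  have h := hasStrictFDerivAt_psi p hy (S := S)
  have e : (mulVecCLM (jacMatrix S p)) =
      ((mulVecCLM (jacMatrix S p)).toContinuousLinearEquivOfDetNeZero hdet : (Fin 5 → ℝ) →L[ℝ] (Fin 5 → ℝ)) := by
    ext v; rfl
  rw [e] at h
  exact h.map_nhds_eq_of_equiv

/-- Hence `Ψ` maps neighbourhoods of such points to neighbourhoods of their images. [folklore] -/
theorem image_mem_nhds_psi {p : Fin 5 → ℝ} (hy : 0 < p 1) (hJ : jacIJ S (p 3) (p 4) ≠ 0)
    {U : Set (Fin 5 → ℝ)} (hU : U ∈ nhds p) : psi S '' U ∈ nhds (psi S p) := by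
  rw [← map_nhds_psi p hy hJ]
  exact Filter.image_mem_map hU

/-! ## The change of variables formula -/

/-- **Volume of an image under `Ψ`** (Mathlib's change of variables for injective differentiable
maps): for a measurable `T ⊆ {y > 0}` on which `Ψ` is injective,
`vol(Ψ(T)) = ∫_T (1/27) y⁻² |∂(I,J)/∂(α,β)| dx dy dθ dα dβ` — Bhargava–Shankar's
`∫_{g·R} dv = (2/27) ∫_R ∫ dg dI dJ` (Prop. 2.7) in coordinates, for their `dg = ½ y⁻² dx dy dθ`.
[cite: BhargavaShankarAnnals2015, Props. 2.7–2.8 (arXiv:1006.1002v2 numbering)] -/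
theorem volume_image_psi {T : Set (Fin 5 → ℝ)} (hT : MeasurableSet T) (hT1 : T ⊆ {p | 0 < p 1})
    (hinj : Set.InjOn (psi S) T) :
    volume (psi S '' T) =
      ∫⁻ p in T, ENNReal.ofReal (|1 / 27 * ((p 1)⁻¹) ^ 2 * jacIJ S (p 3) (p 4)|) := by
  rw [← lintegral_abs_det_fderiv_eq_addHaar_image volume hT
    (fun p hp => (hasFDerivAt_psi p (hT1 hp)).hasFDerivWithinAt) hinj]
  apply setLIntegral_congr_fun hT
  intro p hp
  simp only []
  rw [det_mulVecCLM_jacMatrix (hT1 hp)]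

end BinaryQuartic

end Literature.NumberTheory.EllipticCurves

end
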